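import Summits.BirchSwinnertonDyer.Rank1Residual.Additive.PotSupersingularClasses
import Literature.NumberTheory.EllipticCurves.GaloisAction
import HarnessLib

/-!
# O6 — T-O6-LGC3: the MULTIPLICITY MODULE law at a wild `3` with `f₃ = 4` ("`Mult(𝔪) ≅ Π(ρ̄|G_ℚ₃)`"), typed in its
# classical form as an EVIDENCE-labelled conjecture item over a mod-3 multiplicity INTERFACE (nothing asserted; 0 facts)
(cell `b2b-bsdres`, lane CLASS-CLOSURE, class O6, planner o6-r2 GEN 15 — memo `HOME/b2b-bsdres-o6-r2/gen15/O6-GEN15.md` §2–§4,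
 TARGETS §O6 `#### o6-r2 GEN 15` (G15-3); typer of record cc-typer-5 GEN 11, "typer (idle only)" ask of INBOX 2026-08-22T02:08Z.)

HONEST FRAMING (cell `b2b-bsdres`, verbatim in every file): the goal of the cell is to DELETE the COMBINATION-SHAPED
residual classes of the Birch–Swinnerton-Dyer formula for ALL analytic-rank `≤ 1` elliptic curves over `ℚ` — "full BSD
formula for every rank `≤ 1` curve in class `C`" assembled STRICTLY from published theorems — so that the rank-`≤ 1`
remainder becomes exactly the CONSTRUCTION-SHAPED classes, which are TYPED (missing-input `Prop`s), NOT attempted.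
Lane CLASS-CLOSURE: census output is EVIDENCE / conjecture items with held-out validation, never a Literature fact.

THE OBJECT (memo §2). `M` prime to `3`, `S̄` = the compactified modular curve of level `K(9)·K₀(M)`, `G = PGL₂(ℤ/9)` acting
through the level-`9` structure, `V = H₁(S̄, 𝔽₃)`, `𝕋` = the ANEMIC Hecke algebra (`T_ℓ`, `ℓ ∤ 3M`, and `G`), `𝔪` the non-Eisenstein
maximal ideal of an O6 row `E` of conductor `81M` with `E[3]` irreducible, `Tor(𝔪) = V_𝔪[𝔪] ≅ ρ̄ ⊗ Mult(𝔪)` (Boston–Lenstra–Ribet),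
`Mult(𝔪) := Hom_{G_ℚ}(ρ̄, Tor(𝔪))`, an `𝔽₃[G]`-module. For a level subgroup `H ≤ G` (dictionary `G, B3, B9, B27, T, ⟨s⟩` ↔ the
quotient curves `X₀(M), X₀(3M), X₀(9M), X₀(27M), X₀(81M), X_Δ(81M)`), under the memo's PROP (P) `dim Mult(𝔪)^{H̄}` = the classical
mod-`3` multiplicity of `ρ̄` in `J_H[𝔪]`. **T-O6-LGC3** (memo §2.3): `Mult(𝔪) ≅ Π(shape(𝔪))` with `Π(II)` a FIXED 16-dimensional and
`Π(II*)` a FIXED 22-dimensional `𝔽₃[PGL₂(ℤ/9)]`-module, `Π(IV*) = Π(II) ⊗ sgn`, `Π(IV) = Π(II*) ⊗ sgn`; EQUIVALENTLY (under (P)) the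
classical multiplicities are the shape's profile `(0,0,1,2,4,8)` [II], `(0,1,2,3,4,8)` [IV*], `(1,2,3,4,6,11)` [II*], `(0,0,2,4,6,11)` [IV] —
independent of `M`, of the number of congruent eigenforms and of level raising at `ℓ ∣ M`.

WHAT IS TYPED. Mathlib has no modular curve of level `K(9)`, no `H₁`, no `PGL₂(ℤ/9)`-module theory of it; the module form of
T-O6-LGC3 (Loewy layers, socles) therefore stays in the memo. Typed here is the CLASSICAL FORM over an INTERFACE
`AnemicModThreeMultiplicity` (definition request D-O6-MULT: `mult M H a` = multiplicity of `ρ̄_𝔪` in `J_H(ℚ̄)[𝔪]` for the anemic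
`𝔪 = (3, T_ℓ − a ℓ : ℓ ∤ 3M)`; the sister of `O5.ModPHeckeMultiplicity`, which is the FULL Hecke algebra at `Γ₀(N)` and hence a
different currency), the profile table `lgcProfileThree`, and the node `MultiplicityModuleLawThree T`. A HYPOTHESIS / conjecture item
(used as `(h : MultiplicityModuleLawThree T)`), never a fact; no mark of `RESIDUAL-MAP.md` moves; slots T-O6-A / T-O6-C unchanged.
EVIDENCE (memo §3; instruments `gen15/multtest.py` I-O6-MULT, `embedtest.py`, `isotest.py`; kit j144657 / j144658 / j144775 / j144776):
46 / 46 `E[3]`-irreducible O6 systems ON (18 levels `M = 5 … 67`; 36 très + 10 peu; orbits of 1, 2, 3 curves; `n ∈ {162, 324, 486}`;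
level-raising multiplicities up to 16 at `ℓ = 2`): exactly ONE `Mult`-pattern per shape, `d(𝔪) = 1`; `G`-ISOMORPHISM certified on the 14
systems with matrices. FALSIFIER: one `E[3]`-irreducible O6 system with `f₃ = 4` whose profile is not `lgcProfileThree (shape)`.
LITERATURE (memo §4, labelled): Emerton, local-global compatibility Thm 1.2.1(b)/1.2.6 EXCLUDES `ρ̄|G_ℚ₃` of the form `χ ⊗ (1 *; 0 ε̄)`
— at `p = 3` every O6 row is excluded [corpus: paper:url-d59c8f2acabc pp. 3–6]; Emerton–Gee–Savitt (Breuil lattice conjecture) is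
`p ≥ 5`, tame, generic [corpus: paper:arxiv-1305.1594 p. 4, p. 9]; the qualitative antecedent of multiplicity > 1 at `p³ ∣ N` is
Mazur–Ribet 1991 §13 via [corpus: Agashe–Ribet–Stein doi-10-1007-978-1-4614-1260-1-2 pp. 4–5]; the VALUES at `3⁴ ∣ N` are not in
print (planner's presearch, corpus + galaxy: none).
§3 (o6-r2 GEN 16, cc-typer-5 GEN 13; NEW declarations, the GEN 15 statements byte-unchanged): the exact-profile reading is the
MINIMAL-level case — the law is GRADED, **T-O6-LGC3′ `MultiplicityModuleLawThreeGraded`**: `Mult(𝔪) ≅ Π(shape)^{⊕ 2^s}`,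
`s = #nonMinimalPrimesThree W` (the elementary non-minimality predicate `IsNonMinimalPrimeThree` on `v_ℓ(N), v_ℓ(Δ_min), v_ℓ(j)`);
`MultiplicityModuleLawThreeMin` (`s = 0`) with `graded_imp_min`, `min_of_exact` PROVED; ERRATUM recorded on `MultiplicityModuleLawThree`
(measured `d = 2` at `N = 2268, 3969, 5265`; predictor 112/112).
-/

open WeierstrassCurve Literature.NumberTheory.EllipticCurves

open Literature.NumberTheory.DiophantineGeometry (KodairaSymbol)

namespace Summit.BirchSwinnertonDyer.Rank1Residual.Additive

/-! ## §1 The level subgroups and the profile table -/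

/-- The six level subgroups `H ≤ G = PGL₂(ℤ/9)` of the memo's dictionary, named by their quotient curves:
`G ↔ X₀(M)`, `B3 ↔ X₀(3M)`, `B9 ↔ X₀(9M)`, `B27 ↔ X₀(27M)`, `T ↔ X₀(81M)`, `s ↔ X_Δ(81M)` (memo §2). [folklore] -/
inductive LevelNineSubgroup
  | G | B3 | B9 | B27 | T | s
  deriving DecidableEq, Repr

/-- Read a six-entry profile `(m(M), m(3M), m(9M), m(27M), m(81M), m(X_Δ(81M)))` at a level subgroup. -/
def LevelNineSubgroup.read (v : ℕ × ℕ × ℕ × ℕ × ℕ × ℕ) : LevelNineSubgroup → ℕ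
  | .G => v.1
  | .B3 => v.2.1
  | .B9 => v.2.2.1
  | .B27 => v.2.2.2.1
  | .T => v.2.2.2.2.1
  | .s => v.2.2.2.2.2

/-- **The T-O6-LGC3 profile table** (memo §2.3, "Equivalently (under (P))"): the classical mod-`3` multiplicities of `ρ̄` in
`(J₀(M), J₀(3M), J₀(9M), J₀(27M), J₀(81M), J(X_Δ(81M)))` by Kodaira symbol at `3`: `II ↦ (0,0,1,2,4,8)`, `IV* ↦ (0,1,2,3,4,8)`
(très ramifié), `II* ↦ (1,2,3,4,6,11)`, `IV ↦ (0,0,2,4,6,11)` (peu ramifié); `none` on the other symbols (not O6-with-`f₃ = 4` shapes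
of the census). The entries `4` / `6` at `X₀(81M)` are the failure of classical multiplicity one at conductor exponent `4`. -/
def lgcProfileThree : KodairaSymbol → Option (ℕ × ℕ × ℕ × ℕ × ℕ × ℕ)
  | .II => some (0, 0, 1, 2, 4, 8)
  | .IVstar => some (0, 1, 2, 3, 4, 8)
  | .IIstar => some (1, 2, 3, 4, 6, 11)
  | .IV => some (0, 0, 2, 4, 6, 11)
  | _ => none

/-- Bookkeeping visible in the table: the profiles are non-decreasing along `M ∣ 3M ∣ 9M ∣ 27M ∣ 81M`, the `X_Δ(81M)` entry is
`8` (très) / `11` (peu), and `IV*`/`IV` differ from `II`/`II*` only below level `81M` (the `⊗ sgn` twist is invisible at `T` and `s`). -/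
theorem lgcProfileThree_shape :
    (∀ k ∈ [KodairaSymbol.II, .IVstar, .IIstar, .IV], ∀ v, lgcProfileThree k = some v →
      v.1 ≤ v.2.1 ∧ v.2.1 ≤ v.2.2.1 ∧ v.2.2.1 ≤ v.2.2.2.1 ∧ v.2.2.2.1 ≤ v.2.2.2.2.1 ∧ v.2.2.2.2.1 ≤ v.2.2.2.2.2) ∧
    ((lgcProfileThree .II).map (LevelNineSubgroup.read · .T) = some 4 ∧ (lgcProfileThree .IVstar).map (LevelNineSubgroup.read · .T) = some 4 ∧
     (lgcProfileThree .IIstar).map (LevelNineSubgroup.read · .T) = some 6 ∧ (lgcProfileThree .IV).map (LevelNineSubgroup.read · .T) = some 6) ∧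
    ((lgcProfileThree .II).map (LevelNineSubgroup.read · .s) = (lgcProfileThree .IVstar).map (LevelNineSubgroup.read · .s) ∧
     (lgcProfileThree .IIstar).map (LevelNineSubgroup.read · .s) = (lgcProfileThree .IV).map (LevelNineSubgroup.read · .s)) := by
  refine ⟨?_, by decide, by decide⟩
  intro k hk v hv
  simp only [List.mem_cons, List.not_mem_nil, or_false] at hk
  rcases hk with rfl | rfl | rfl | rfl <;> simp only [lgcProfileThree, Option.some.injEq] at hv <;> subst hv <;> decide

/-! ## §2 The interface D-O6-MULT and the conjecture item -/

/-- **D-O6-MULT (definition request; INTERFACE, nothing constructed).** An anemic mod-`3` multiplicity theory at level `9`: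
for `M` prime to `3`, a level subgroup `H` and an integral eigenvalue system `a : ℕ → ℤ` (read at primes `ℓ ∤ 3M`),
`mult M H a` is to mean the multiplicity of `ρ̄_𝔪` in `J_H(ℚ̄)[𝔪]` — `J_H` the Jacobian of the quotient of `X_{K(9)·K₀(M)}` by `H`
(so `X₀(M), …, X₀(81M), X_Δ(81M)`), `𝔪 = (3, T_ℓ − a ℓ : ℓ ∤ 3M prime)` in the ANEMIC Hecke algebra — and `0` unless `𝔪` is maximal with
`ρ̄_𝔪` absolutely irreducible; under the memo's (P) this is `dim_{𝔽₃} Mult(𝔪)^{H̄}`. Sister of `O5.ModPHeckeMultiplicity` (full Hecke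
algebra with `U_q`, `q ∣ N` — a different currency: level raising at `ℓ ∣ M` splits those ideals, not these). Mathlib has no `J_H`
and no Hecke ring; every statement below is over this interface. -/
structure AnemicModThreeMultiplicity where
  /-- `mult M H a` = multiplicity of `ρ̄_𝔪` in `J_H(ℚ̄)[𝔪]`, `𝔪` the anemic ideal of the system `a` at tame level `M`. -/
  mult : ℕ → LevelNineSubgroup → (ℕ → ℤ) → ℕ

variable (T : AnemicModThreeMultiplicity)

/-- **T-O6-LGC3 — the multiplicity module law at a wild `3`, classical form (conjecture item, EVIDENCE; o6-r2 GEN 15).** For every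
elliptic `W/ℚ` in class O6 with `f₃(W) = 4` (conductor `81M`, `3 ∤ M`), `W[3]` irreducible and Kodaira symbol at `3` one of
`II, IV*, II*, IV`, the anemic mod-`3` multiplicities of `ρ̄_{W,3}` in `J₀(M), J₀(3M), J₀(9M), J₀(27M), J₀(81M), J(X_Δ(81M))` are the
shape's row of `lgcProfileThree` — independent of `M`, of the number of congruent eigenforms and of level raising at `ℓ ∣ M`
("multiplicity one for `Mult`"). The census form of mod-`3` local–global compatibility in the non-generic `p = 3`, conductor-`3⁴` block
that Emerton's theorem and Emerton–Gee–Savitt exclude (module docstring). EVIDENCE 46/46 systems; falsifier: one system off the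
table. With the SIEVE LEMMA (memo §2.2) it re-derives THEOREM J (très) with equality and reduces CONJ J (peu) to one finite fact about
`Π(II*)`. A HYPOTHESIS shape over the interface, never a fact. **ERRATUM (o6-r2 GEN 16, memo `gen16/O6-GEN16.md` §1; statement
UNCHANGED): as typed this is the `s = 0` (MINIMAL-level) case of the GRADED law T-O6-LGC3′ (`MultiplicityModuleLawThreeGraded`, §3
below); its INTENDED instance (D-O6-MULT realised) violates it at the non-minimal levels `N = 2268, 3969, 5265` (tables A/B/C2:
`Mult ≅ Π(shape)^{⊕2}` there); since `T` is an abstract interface nothing in the tree is false, and consumers should take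
`MultiplicityModuleLawThreeGraded T` (or `MultiplicityModuleLawThreeMin T`, which this node implies: `min_of_exact`).** [folklore] -/
@[conjecture] def MultiplicityModuleLawThree : Prop :=
  ∀ (W : WeierstrassCurve ℚ) [W.IsElliptic] [W.IsGloballyMinimal],
    ClassO6 W 3 → condExp W 3 = 4 → W.HasIrreducibleModPGaloisRep 3 →
      ∀ v, lgcProfileThree (W.kodairaSymbolAt (placeOf 3)) = some v →
        ∀ H : LevelNineSubgroup, T.mult (W.conductorNorm ℤ / 3 ^ 4) H (fun q ↦ W.LFunction q) = H.read v

/-- Reading of the node at the two extreme subgroups: on a très row (`II` / `IV*`) the multiplicity in `J₀(81M)` is `4` and in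
`J(X_Δ(81M))` is `8`; on a peu row (`II*` / `IV`) they are `6` and `11`. [folklore] -/
theorem MultiplicityModuleLawThree.at_top (h : MultiplicityModuleLawThree T) (W : WeierstrassCurve ℚ) [W.IsElliptic]
    [W.IsGloballyMinimal] (hO : ClassO6 W 3) (hf : condExp W 3 = 4) (hirr : W.HasIrreducibleModPGaloisRep 3) :
    ((W.kodairaSymbolAt (placeOf 3) = .II ∨ W.kodairaSymbolAt (placeOf 3) = .IVstar) →
      T.mult (W.conductorNorm ℤ / 3 ^ 4) .T (fun q ↦ W.LFunction q) = 4 ∧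
      T.mult (W.conductorNorm ℤ / 3 ^ 4) .s (fun q ↦ W.LFunction q) = 8) ∧
    ((W.kodairaSymbolAt (placeOf 3) = .IIstar ∨ W.kodairaSymbolAt (placeOf 3) = .IV) →
      T.mult (W.conductorNorm ℤ / 3 ^ 4) .T (fun q ↦ W.LFunction q) = 6 ∧
      T.mult (W.conductorNorm ℤ / 3 ^ 4) .s (fun q ↦ W.LFunction q) = 11) := by
  have key := h W hO hf hirr
  constructor
  · rintro (hk | hk) <;> rw [hk] at key
    · exact ⟨key _ rfl .T, key _ rfl .s⟩
    · exact ⟨key _ rfl .T, key _ rfl .s⟩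
  · rintro (hk | hk) <;> rw [hk] at key
    · exact ⟨key _ rfl .T, key _ rfl .s⟩
    · exact ⟨key _ rfl .T, key _ rfl .s⟩

/-! ## §3 T-O6-LGC3′ — the GRADED multiplicity law (o6-r2 GEN 16; NEW declarations, nothing above edited in its statement)

o6-r2 GEN 16 (memo `HOME/b2b-bsdres-o6-r2/gen16/O6-GEN16.md` sha16 `04d878e600b14c1e`, §1; TARGETS §O6 `#### o6-r2 GEN 16`; typer ask
§1.4 (a)–(d), INBOX 2026-08-22T04:34Z; typer of record cc-typer-5 GEN 13). MEASURED (§1.1; kit j144657 A / j144658 B / j144775 C1 /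
j144776 C2, tables `gen16/table_A.md` `9ad67c186db49755`, `table_B.md` `464c1eb717b5f150`, `table_C1.md` `cfb57a5ba2289c05`, `table_C2.md`
`2a58a67ce46af405`): every `E[3]`-irreducible system has profile EXACTLY `d·v(shape)` with `d ∈ {1, 2}` (socle/cosocle multiplied by
`d`): `d = 2` on the six NON-MINIMAL systems 2268a1/b1 (`ℓ = 2`, `4 ∥ N`), 3969a1/e1 (`ℓ = 7`, `49 ∥ N`, `v₇(Δ) = 8`), 5265d1/p1
(`ℓ = 13 ∥ N`, `v₁₃(Δ) = 3`; both PREDICTED before parsing C2), `d = 1` on the other 106 measured labels. STATEMENT (§1.2, T-O6-LGC3′):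
`Mult(𝔪_W) ≅ Π(shape)^{⊕ d}`, `d = ∏_{ℓ ∣ M} (1 + v_ℓ(N) − a_ℓ(ρ̄)) = 2^{s(W)}`, `s(W) = #{ℓ ∣ M : ρ̄ non-minimal at ℓ}` with the ELEMENTARY
predicate (`p = 3`, `ℓ ≠ 3`, Cremona-minimal `Δ`): `ℓ ∥ N`: non-minimal ⟺ `3 ∣ v_ℓ(Δ)`; `ℓ² ∥ N`: non-minimal ⟺ `ℓ = 2 ∨ (v_ℓ(j) ≥ 0 ∧
v_ℓ(Δ) ≡ ±4 (mod 12))`; `v_ℓ(N) ≥ 3`: minimal — hence `dim Mult^{H̄} = 2^s · H.read v` for every level-nine subgroup `H`. PREDICTOR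
(§1.3; `gen16/predict_d.py` `3ed5d1ac085b82a3` → `predicted_d.tsv` `359d1a122823a0e0`): 420 `E[3]`-irreducible rows, `d = 1`: 352,
`d = 2`: 68, `d ≥ 4`: 0; against every measured label (A + B + C1 + C2, 112 labels) 112/112, 0 mismatches. Interpretation (memo): `d` =
the Casselman new-vector / Ihara degeneracy count; why it might fail: `ℓ ≡ 1 (mod 3)` with `ρ̄(Frob_ℓ)` scalar (no such level in reach).
-/

section Graded

variable {T}

/-- **o6-r2 GEN 16 §1.2: `ρ̄_{W,3}` is NON-MINIMALLY ramified at the prime `ℓ`** (`a_ℓ(ρ̄) < v_ℓ(N)`), by the memo's ELEMENTARY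
predicate at `p = 3`, `ℓ ≠ 3`, on the tree's columns `v_ℓ(N) = padicValNat ℓ (W.conductorNorm ℤ)`, `v_ℓ(Δ_min) = padicValInt ℓ
W.minimalDiscriminantInt`, `v_ℓ(j) = padicValRat ℓ W.j`: `ℓ ∥ N` and `3 ∣ v_ℓ(Δ)` (Tate curve: `ρ̄` unramified at `ℓ`), or `ℓ² ∥ N` and
(`ℓ = 2`, or `v_ℓ(j) ≥ 0` with `v_ℓ(Δ) ≡ ±4 (mod 12)`: potentially good with `Φ = C₃` acting unipotently mod `3`); `v_ℓ(N) ≥ 3` is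
minimal. (For `p = 3`, `ℓ ≠ 3`: `v_ℓ(N) − a_ℓ(ρ̄) ∈ {0, 1}`.) A predicate with a body; nothing asserted. [folklore] -/
def IsNonMinimalPrimeThree (W : WeierstrassCurve ℚ) [W.IsElliptic] [W.IsGloballyMinimal] (ℓ : ℕ) : Prop :=
  ℓ.Prime ∧ ℓ ≠ 3 ∧
    ((padicValNat ℓ (W.conductorNorm ℤ) = 1 ∧ 3 ∣ padicValInt ℓ W.minimalDiscriminantInt) ∨
     (padicValNat ℓ (W.conductorNorm ℤ) = 2 ∧
        (ℓ = 2 ∨ (0 ≤ padicValRat ℓ W.j ∧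
          (padicValInt ℓ W.minimalDiscriminantInt % 12 = 4 ∨ padicValInt ℓ W.minimalDiscriminantInt % 12 = 8)))))

open scoped Classical in
/-- **(a) `nonMinimalPrimesThree W`** = the primes `ℓ ∣ N` (so `ℓ ∣ M = N/81` once `ℓ ≠ 3`) at which `ρ̄_{W,3}` is non-minimally ramified
(o6-r2 GEN 16 §1.4 (a)); `s(W)` = its cardinality, `d(W) = 2^{s(W)}`. [folklore] -/
noncomputable def nonMinimalPrimesThree (W : WeierstrassCurve ℚ) [W.IsElliptic] [W.IsGloballyMinimal] : Finset ℕ :=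
  (W.conductorNorm ℤ).primeFactors.filter (IsNonMinimalPrimeThree W)

/-- Members of `nonMinimalPrimesThree W` are prime factors of the conductor other than `3`. [folklore] -/
theorem mem_nonMinimalPrimesThree_iff (W : WeierstrassCurve ℚ) [W.IsElliptic] [W.IsGloballyMinimal] (ℓ : ℕ) :
    ℓ ∈ nonMinimalPrimesThree W ↔ ℓ ∈ (W.conductorNorm ℤ).primeFactors ∧ IsNonMinimalPrimeThree W ℓ := by
  classical
  simp [nonMinimalPrimesThree, Finset.mem_filter]

variable (T)

/-- **(b) T-O6-LGC3′ `MultiplicityModuleLawThreeGraded` — the GRADED multiplicity module law at a wild `3`, classical form (conjecture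
item, EVIDENCE; o6-r2 GEN 16 §1.2; SUPERSEDES the exact-profile reading of `MultiplicityModuleLawThree`).** For every elliptic `W/ℚ`
in class O6 with `f₃(W) = 4` (conductor `81M`), `W[3]` irreducible and Kodaira symbol at `3` one of `II, IV*, II*, IV`, and every
level-nine subgroup `H`: the anemic mod-`3` multiplicity of `ρ̄_{W,3}` in `J_H[𝔪]` is **`2^{s(W)} · (H.read v)`**, `v` the shape's row of
`lgcProfileThree`, `s(W) = #nonMinimalPrimesThree W` — `Mult(𝔪) ≅ Π(shape)^{⊕ 2^s}`. EVIDENCE: measured 112/112 labels (d = 2 on the 6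
non-minimal systems at `N = 2268, 3969, 5265`, two predicted first; d = 1 on 106), predictor 420 rows (352 / 68 / 0), 0 mismatch;
falsifier: one `E[3]`-irreducible O6 system with `f₃ = 4` off `2^s ·` table (candidate mechanism: `ℓ ≡ 1 (3)` with `ρ̄(Frob_ℓ)`
scalar). Downstream (SIEVE LEMMA, THEOREM J / CONJ J) unchanged: they use `Π(shape)`, not `d`. A HYPOTHESIS shape, never a fact.
[folklore] -/
@[conjecture] def MultiplicityModuleLawThreeGraded : Prop :=
  ∀ (W : WeierstrassCurve ℚ) [W.IsElliptic] [W.IsGloballyMinimal],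
    ClassO6 W 3 → condExp W 3 = 4 → W.HasIrreducibleModPGaloisRep 3 →
      ∀ v, lgcProfileThree (W.kodairaSymbolAt (placeOf 3)) = some v →
        ∀ H : LevelNineSubgroup,
          T.mult (W.conductorNorm ℤ / 3 ^ 4) H (fun q ↦ W.LFunction q) = 2 ^ (nonMinimalPrimesThree W).card * H.read v

/-- **(c) `MultiplicityModuleLawThreeMin` — the MINIMAL-level case** (`s(W) = 0`: no non-minimal prime): the multiplicities are the
shape's profile exactly ("multiplicity one for `Mult`"). This is what the census of o6-r2 GEN 15 (46/46, all minimal) actually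
supported; implied by the graded law (`graded_imp_min`) and by the old exact node (`min_of_exact`). Conjecture item; never a fact.
[folklore] -/
@[conjecture] def MultiplicityModuleLawThreeMin : Prop :=
  ∀ (W : WeierstrassCurve ℚ) [W.IsElliptic] [W.IsGloballyMinimal],
    ClassO6 W 3 → condExp W 3 = 4 → W.HasIrreducibleModPGaloisRep 3 → nonMinimalPrimesThree W = ∅ →
      ∀ v, lgcProfileThree (W.kodairaSymbolAt (placeOf 3)) = some v →
        ∀ H : LevelNineSubgroup, T.mult (W.conductorNorm ℤ / 3 ^ 4) H (fun q ↦ W.LFunction q) = H.read v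

variable {T}

/-- **`graded_imp_min` (PROVED): the graded law gives the minimal-level law** (`s = 0 ⇒ 2^0 · v = v`). [folklore] -/
theorem graded_imp_min (h : MultiplicityModuleLawThreeGraded T) : MultiplicityModuleLawThreeMin T := by
  intro W _ _ hO hf hirr hmin v hv H
  rw [h W hO hf hirr v hv H, hmin, Finset.card_empty, pow_zero, one_mul]

/-- **`min_of_exact` (PROVED): the old exact-profile node implies the minimal-level law** — so nothing typed in GEN 15 is lost;
only its reading on non-minimal levels is withdrawn (ERRATUM on `MultiplicityModuleLawThree`). [folklore] -/
theorem min_of_exact (h : MultiplicityModuleLawThree T) : MultiplicityModuleLawThreeMin T :=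
  fun W _ _ hO hf hirr _ v hv H => h W hO hf hirr v hv H

/-- Reading of the graded node on a row with exactly ONE non-minimal prime (`s = 1`, e.g. 2268a1, 3969a1, 5265d1): every
multiplicity DOUBLES — on a très row `8` in `J₀(81M)` and `16` in `J(X_Δ(81M))`. [folklore] -/
theorem MultiplicityModuleLawThreeGraded.at_top_of_card_eq_one (h : MultiplicityModuleLawThreeGraded T)
    (W : WeierstrassCurve ℚ) [W.IsElliptic] [W.IsGloballyMinimal] (hO : ClassO6 W 3) (hf : condExp W 3 = 4)
    (hirr : W.HasIrreducibleModPGaloisRep 3) (hs : (nonMinimalPrimesThree W).card = 1)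
    (hk : W.kodairaSymbolAt (placeOf 3) = .II ∨ W.kodairaSymbolAt (placeOf 3) = .IVstar) :
    T.mult (W.conductorNorm ℤ / 3 ^ 4) .T (fun q ↦ W.LFunction q) = 8 ∧
      T.mult (W.conductorNorm ℤ / 3 ^ 4) .s (fun q ↦ W.LFunction q) = 16 := by
  have key := h W hO hf hirr
  rcases hk with hk | hk <;> rw [hk] at key
  · exact ⟨by rw [key _ rfl .T, hs]; decide, by rw [key _ rfl .s, hs]; decide⟩
  · exact ⟨by rw [key _ rfl .T, hs]; decide, by rw [key _ rfl .s, hs]; decide⟩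

end Graded

end Summit.BirchSwinnertonDyer.Rank1Residual.Additive
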